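import Summits.QuantumFields.BalabanUV.T4Continuum.Support.NE7PushForwardContinuity
import Summits.QuantumFields.BalabanUV.T4Continuum.Support.NE7ExactCurrent
import Summits.QuantumFields.BalabanUV.T4Continuum.Support.NE7CritContinuityMethod
import Summits.QuantumFields.BalabanUV.T4Continuum.Support.AveragingDeficitMultiLevelBridge
import Summits.QuantumFields.BalabanUV.T4Continuum.Support.MinimalActionRate
import Mathlib.Topology.Order.Compact
import HarnessLib

/-!
# NE7CritClosed — CRITICALITY ON THE TANGENT SPACE OF THE CONSTRAINT FIBRE IS A CLOSED CONDITION ON THE CLASS (the letter CRIT-CLOSED of F16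
# DISCHARGED, tangent currency), and the continuity method for CRIT-ONE-STEP with ONLY (OPEN) and (PATH) left as hypotheses

Cell `pub-balaban`, rung (B)+1 sub-cell t4, lineage `b2b-balaban-t4-ne7-p1`, generation 67 (CRUX PROVER NE7 #1); hunt (h11), memo
`t4/b2b-balaban-t4-ne7-p1-g67/HUNT-H11-NORMAL-CURRENCY.md` §3.  File F18 (over F17 `NE7PushForwardContinuity`; currency: criticality on the TANGENT
space `T(U) = {φ skew, periodic : TangentIter L k U φ}` of the `(k+1)`-fold average — the currency of the slice `T_♮(U) ⊆ T(U)` that CONV (F9 ∕ F15) consumes;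
[tree] `AveragingDeficitMultiLevelPrep.levelQ'_resDir_eq_zero` maps it into the `ker levelQ'` currency of F8 ∕ F10 ∕ F16).

THE ARGUMENT (§2).  Let `U` lie in the closure of `C = {V ∈ sfClass | V critical on T(V)}`; `U ∈ sfClass` (closed).  Fix `φ ∈ T(U)`.  For `V ∈ C` near
`U` put `φ_V := φ − liftIter_V(cpushIter_V φ)` — tangent at `V` ([tree] `ReplicationRightInverse.tangentIter_sub_liftIter`), skew, periodic — so
`dAction V φ = dAction V (liftIter_V(cpushIter_V φ))`, bounded by `2·Σ_{p, b⊂∂p} ‖(cpushIter_V φ)(⌊b⌋)‖` ([tree] `norm_liftIter_le_two`, `norm_curlAt_le`):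
FINITELY MANY coordinates of `V ↦ cpushIter L k V φ`, each continuous on the class (F17) and `0` at `U`.  Hence `dAction V φ → 0` and `→ dAction U φ`
(continuity of `dAction` in the background, §1) along `𝓝[C] U ≠ ⊥`: `dAction U φ = 0`.  No sup over the torus, no uniformity in the level.

WHAT ([folklore]; 0 def, 0 sorry).  §1 `continuous_dAction`, `abs_dAction_le_sum_norm`, `isSkewDir_cpushIter`, `isPeriodicDir_cpushIter`;
§2 **`isClosed_tanCritical`** — CRIT-CLOSED; §3 the continuity method with an ABSTRACT criticality predicate (`isClosed_critSet_param'`,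
`critOneStep_of_continuity'` — F16's proofs verbatim) and **`critOneStep_tan_of_continuity`**: CRIT-ONE-STEP (tangent currency) at every point of a
continuous data path from: CRIT at `γ 0`, (OPEN); CLOSED fully discharged.
HONEST FRAMING (page 1).  Soft topology + kinematics; (OPEN) (= a-priori estimate with margin + IFT on the slice) and the data path are HYPOTHESES carrying
all the analysis; NOT CRIT-ONE-STEP, NOT NE7; spine 0∕9; finite T⁴ rung (B)+1 — NOT infinite volume, NOT mass gap, NOT Clay.  Continuum YM on T⁴ ⇐
BetaPertH ∧ nine spine estimates (0/9 proved); BetaPertH ⇐ (D1) ∧ (D4) ∧ CAP+tail; G-an2-4 gates asym, D1 and NE2/3/4.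
-/

set_option autoImplicit false

open scoped BigOperators Matrix Matrix.Norms.L2Operator Topology
open NormedSpace Finset Set Filter

namespace Summit.QuantumFields.BalabanUV.T4Continuum.NE7CritClosed

open Literature.MathematicalPhysics.QuantumFieldTheory.Balaban1983to89
open B7Prop1Explicit B7Prop2Explicit MatrixLog UnitaryModel MatrixNorms
open T4AveragingDeficitWall (IsUnitaryCfg IsSkewDir SmallField vary Ad curl curlAt fhol nReTrL nReTrL_apply)
open T4AveragingDeficitWallBoundary (IsPeriodicCfg periodBox)
open AveragingDeficitPeriodicCounting (IsPeriodicDir)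
open AveragingDeficitTransport (mem_U1_of_unitary)
open AveragingDeficitChartCalculus (cavg)
open AveragingDeficitFermat (isPeriodicCfg_cavg)
open AveragingDeficitTwoLevelPrep (prop1Radius)
open AveragingDeficitMultiLevelPrep (cpush LevelSmall TangentIter tower isPeriodicDir_cpush)
open AveragingDeficitMultiLevelBridge (tower_eq)
open MinimalActionLevels (perWin)
open MinimalActionSandwich (admissible)
open MinimalActionRate (sfClass)
open MinimalActionCompact (continuous_eval continuous_val_hol isCompact_sfClass continuousOn_avgIter isClosed_smallField)
open NE3HessForm (dAction)
open NE3HessBounds (norm_curlAt_le)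
open NE7ExactCurrent (dAction_add)
open ReplicationRightInverse (cpushIter liftIter tangentIter_iff_cpushIter_eq_zero tangentIter_sub_liftIter isSkewDir_liftIter
  isPeriodicDir_liftIter next_level small512_of_levelSmall)
open ReplicationRightInverseBound (cdivIter norm_liftIter_le_two)
open NE7PushForwardContinuity (continuousOn_cpushIter)
open NE7CritContinuityMethod (Icc_subset_of_closed_of_relOpen)

noncomputable section

variable {d : ℕ} {n : Type*} [Fintype n] [DecidableEq n]

/-! ## §1 The first variation is continuous in the background and bounded by the direction; the pushed direction is skew and periodic -/

/-- `U ↦ (d_U Y)(p′)` is continuous (product topology; products of bond variables and their inverses). [folklore] -/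
theorem continuous_curlAt (Y : Site d → Fin d → Matrix n n ℂ) (z : Site d) (μ ν : Fin d) :
    Continuous fun U : Site d → Fin d → (Matrix n n ℂ)ˣ => curlAt U Y z μ ν := by
  have hAd : ∀ (u : (Site d → Fin d → (Matrix n n ℂ)ˣ) → (Matrix n n ℂ)ˣ), Continuous u → ∀ X : Matrix n n ℂ,
      Continuous fun U : Site d → Fin d → (Matrix n n ℂ)ˣ => Ad (u U) X := by
    intro u hu X
    unfold Ad
    exact ((Units.continuous_val.comp hu).mul continuous_const).mul (Units.continuous_coe_inv.comp hu)
  have h1 : Continuous fun U : Site d → Fin d → (Matrix n n ℂ)ˣ => U z μ := continuous_eval z μ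
  have h2 : Continuous fun U : Site d → Fin d → (Matrix n n ℂ)ˣ => U z μ * U (z + e μ) ν := h1.mul (continuous_eval _ ν)
  have h3 : Continuous fun U : Site d → Fin d → (Matrix n n ℂ)ˣ => U z μ * U (z + e μ) ν * (U (z + e ν) μ)⁻¹ :=
    h2.mul (continuous_eval _ μ).inv
  unfold curlAt
  exact (((hAd _ h1 _).add (hAd _ h2 _)).sub (hAd _ h2 _)).sub (hAd _ h3 _)

/-- **`U ↦ dAction U Y W` IS CONTINUOUS** for every fixed direction `Y` and window `W`. [folklore] -/
theorem continuous_dAction (Y : Site d → Fin d → Matrix n n ℂ) (W : Finset (T4AveragingDeficitWall.Plaq d)) :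
    Continuous fun U : Site d → Fin d → (Matrix n n ℂ)ˣ => dAction U Y W := by
  unfold dAction
  refine (continuous_finsetSum W fun p _ => ?_).neg
  have h1 : Continuous fun U : Site d → Fin d → (Matrix n n ℂ)ˣ => curl U Y p := continuous_curlAt Y p.1 p.2.1.1 p.2.1.2
  have h2 : Continuous fun U : Site d → Fin d → (Matrix n n ℂ)ˣ => ((fhol U p : (Matrix n n ℂ)ˣ) : Matrix n n ℂ) :=
    continuous_val_hol p.1 _
  have h3 : Continuous fun U : Site d → Fin d → (Matrix n n ℂ)ˣ => curl U Y p * ((fhol U p : (Matrix n n ℂ)ˣ) : Matrix n n ℂ) :=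
    h1.mul h2
  have h4 := (nReTrL (n := n)).continuous.comp h3
  simpa only [Function.comp_def, nReTrL_apply] using h4

/-- **`|dAction U Y W| ≤ Σ_{p∈W} ‖(d_U Y)(p)‖`** for unitary `U` (`|Re tr(A·u)∕N| ≤ ‖A‖`). [folklore] -/
theorem abs_dAction_le_sum_norm [Nonempty n] {U : Site d → Fin d → (Matrix n n ℂ)ˣ} (hU : IsUnitaryCfg U) (Y : Site d → Fin d → Matrix n n ℂ)
    (W : Finset (T4AveragingDeficitWall.Plaq d)) : |dAction U Y W| ≤ ∑ p ∈ W, ‖curl U Y p‖ := by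
  unfold dAction
  rw [abs_neg]
  refine (Finset.abs_sum_le_sum_abs _ _).trans (Finset.sum_le_sum fun p _ => ?_)
  have hu : ‖((fhol U p : (Matrix n n ℂ)ˣ) : Matrix n n ℂ)‖ ≤ 1 := (mem_U1_of_unitary (hol_mem_of hU p.1 _)).1
  calc |nReTr (curl U Y p * ((fhol U p : (Matrix n n ℂ)ˣ) : Matrix n n ℂ))|
      ≤ ‖curl U Y p * ((fhol U p : (Matrix n n ℂ)ˣ) : Matrix n n ℂ)‖ := abs_nReTr_le_opNorm _
    _ ≤ ‖curl U Y p‖ * ‖((fhol U p : (Matrix n n ℂ)ˣ) : Matrix n n ℂ)‖ := norm_mul_le _ _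
    _ ≤ ‖curl U Y p‖ * 1 := by gcongr
    _ = ‖curl U Y p‖ := mul_one _

/-- The pushed direction down the tower is skew for skew data. [folklore] -/
theorem isSkewDir_cpushIter [Nonempty n] {L : ℕ} (hL : 1 ≤ L) (j : ℕ) :
    ∀ {W : Site d → Fin d → (Matrix n n ℂ)ˣ} {x : ℝ}, IsUnitaryCfg W → 0 ≤ x → LevelSmall d L j x → SmallField W x →
      ∀ {φ : Site d → Fin d → Matrix n n ℂ}, IsSkewDir φ → IsSkewDir (cpushIter L j W φ) := by
  induction j with
  | zero =>
      intro W x hW hx hs hWx φ hφ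
      exact NE3QuadRemainderTower.cpush_skew hL hW hx (small512_of_levelSmall hL hx hs) hWx hφ
  | succ j ih =>
      intro W x hW hx hs hWx φ hφ
      obtain ⟨hW', hx', hs', hWx'⟩ := next_level hL hW hx hs hWx
      exact ih hW' hx' hs' hWx' (NE3QuadRemainderTower.cpush_skew hL hW hx (small512_of_levelSmall hL hx hs) hWx hφ)

/-- The pushed direction down the tower of a configuration of period `L·tower L M j` and data of that period has period `M`. [folklore] -/
theorem isPeriodicDir_cpushIter (L M : ℕ) (j : ℕ) :
    ∀ {W : Site d → Fin d → (Matrix n n ℂ)ˣ} {φ : Site d → Fin d → Matrix n n ℂ}, IsPeriodicCfg W ((L : ℤ) * (tower L M j : ℕ)) →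
      IsPeriodicDir φ ((L : ℤ) * (tower L M j : ℕ)) → IsPeriodicDir (cpushIter L j W φ) (M : ℤ) := by
  induction j with
  | zero =>
      intro W φ hW hφ
      exact isPeriodicDir_cpush L M hW hφ
  | succ j ih =>
      intro W φ hW hφ
      have e : ((tower L M (j + 1) : ℕ) : ℤ) = (L : ℤ) * (tower L M j : ℕ) := by
        rw [show tower L M (j + 1) = L * tower L M j from rfl]; push_cast; ring
      have hW' : IsPeriodicCfg (cavg L W) ((L : ℤ) * (tower L M j : ℕ)) := by rw [← e]; exact isPeriodicCfg_cavg L _ hW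
      have hφ' : IsPeriodicDir (cpush L W φ) ((L : ℤ) * (tower L M j : ℕ)) := by rw [← e]; exact isPeriodicDir_cpush L _ hW hφ
      exact ih hW' hφ'

/-! ## §2 CRIT-CLOSED: criticality on the tangent space is closed on the class -/

/-- **CRITICALITY ON THE TANGENT SPACE OF THE `(k+1)`-FOLD AVERAGE IS A CLOSED CONDITION ON THE CLASS** (`L ≥ 2`, `ε ≥ 0`,
`LevelSmall d L k (ε(L^{k+1})^{−2})`).  See the module docstring for the argument. [folklore] -/
theorem isClosed_tanCritical [Nonempty n] {L N k : ℕ} [NeZero N] (hL : 2 ≤ L) {ε : ℝ} (hε : 0 ≤ ε) (hls : LevelSmall d L k (ε / ((L : ℝ) ^ (k + 1)) ^ 2)) :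
    IsClosed {U : Site d → Fin d → (Matrix n n ℂ)ˣ | U ∈ sfClass d L N ε (k + 1) ∧
      ∀ φ : Site d → Fin d → Matrix n n ℂ, IsSkewDir φ → IsPeriodicDir φ ((N * L ^ (k + 1) : ℕ) : ℤ) → TangentIter L k U φ →
        dAction U φ (perWin d (N * L ^ (k + 1))) = 0} := by
  have hL1 : 1 ≤ L := by omega
  set x : ℝ := ε / ((L : ℝ) ^ (k + 1)) ^ 2 with hxdef
  have hx : 0 ≤ x := by rw [hxdef]; positivity
  set W := perWin d (N * L ^ (k + 1)) with hWdef
  set C := {U : Site d → Fin d → (Matrix n n ℂ)ˣ | U ∈ sfClass d L N ε (k + 1) ∧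
      ∀ φ : Site d → Fin d → Matrix n n ℂ, IsSkewDir φ → IsPeriodicDir φ ((N * L ^ (k + 1) : ℕ) : ℤ) → TangentIter L k U φ →
        dAction U φ W = 0} with hC
  have eP : ((N * L ^ (k + 1) : ℕ) : ℤ) = (L : ℤ) * (tower L N k : ℕ) := by rw [tower_eq]; push_cast; ring
  refine isClosed_of_closure_subset fun U hU => ?_
  have hUcl : U ∈ sfClass d L N ε (k + 1) :=
    closure_minimal (fun V (hV : V ∈ C) => hV.1) (isCompact_sfClass (d := d) (n := n) L N ε (k + 1)).isClosed hU
  refine ⟨hUcl, fun φ hφs hφP hφT => ?_⟩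
  obtain ⟨hUu, hUP, hUx⟩ := hUcl
  haveI hne : (𝓝[C] U).NeBot := mem_closure_iff_nhdsWithin_neBot.mp hU
  -- a crude sup bound for the periodic direction: every value is one of the values on the period box
  obtain ⟨s, hs, hφb⟩ : ∃ s : ℝ, 0 ≤ s ∧ ∀ (z : Site d) (μ : Fin d), ‖φ z μ‖ ≤ s := by
    haveI : NeZero (N * L ^ (k + 1)) := ⟨Nat.mul_ne_zero (NeZero.ne N) (pow_ne_zero _ (by omega))⟩
    refine ⟨∑ r : Fin d → Fin (N * L ^ (k + 1)), ∑ μ : Fin d, ‖φ (boxVec (N * L ^ (k + 1)) r) μ‖, by positivity, fun z μ => ?_⟩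
    have hper : φ z μ = φ (boxVec (N * L ^ (k + 1)) (AveragingDeficitTorusChart.redN (N * L ^ (k + 1)) z)) μ := by
      have h := congrFun (congrFun (AveragingDeficitTorusChart.extDir_resDir (N * L ^ (k + 1)) hφP) z) μ
      simpa [AveragingDeficitTorusChart.extDir, AveragingDeficitTorusChart.resDir] using h.symm
    rw [hper]
    have h1 : ‖φ (boxVec (N * L ^ (k + 1)) (AveragingDeficitTorusChart.redN (N * L ^ (k + 1)) z)) μ‖
        ≤ ∑ μ' : Fin d, ‖φ (boxVec (N * L ^ (k + 1)) (AveragingDeficitTorusChart.redN (N * L ^ (k + 1)) z)) μ'‖ :=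
      Finset.single_le_sum (f := fun μ' => ‖φ (boxVec (N * L ^ (k + 1)) (AveragingDeficitTorusChart.redN (N * L ^ (k + 1)) z)) μ'‖)
        (fun _ _ => norm_nonneg _) (Finset.mem_univ μ)
    exact h1.trans (Finset.single_le_sum (f := fun r => ∑ μ' : Fin d, ‖φ (boxVec (N * L ^ (k + 1)) r) μ'‖)
      (fun _ _ => Finset.sum_nonneg fun _ _ => norm_nonneg _) (Finset.mem_univ _))
  -- the limit of the first variation along `𝓝[C] U`
  have hf : Tendsto (fun V : Site d → Fin d → (Matrix n n ℂ)ˣ => dAction V φ W) (𝓝[C] U) (𝓝 (dAction U φ W)) :=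
    ((continuous_dAction φ W).tendsto U).mono_left nhdsWithin_le_nhds
  -- the pushed coordinates tend to `0`
  set γ : (Site d → Fin d → (Matrix n n ℂ)ˣ) → Site d → Fin d → Matrix n n ℂ := fun V => cpushIter L k V φ with hγ
  have hγ0 : ∀ (c : Site d) (i : Fin d), γ U c i = 0 := by
    intro c i
    have h0 : cpushIter L k U φ = 0 := (tangentIter_iff_cpushIter_eq_zero L k U φ).mp hφT
    simp only [hγ, h0, Pi.zero_apply]
  have hγt : ∀ (c : Site d) (i : Fin d), Tendsto (fun V => ‖γ V c i‖) (𝓝[C] U) (𝓝 0) := by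
    intro c i
    have hc : ContinuousWithinAt (fun V : Site d → Fin d → (Matrix n n ℂ)ˣ => cpushIter L k V φ c i)
        {V | IsUnitaryCfg V ∧ SmallField V x} U :=
      continuousOn_cpushIter hL k hx hls hφs hs hφb c i U ⟨hUu, hUx⟩
    have hc' : Tendsto (fun V => γ V c i) (𝓝[C] U) (𝓝 (γ U c i)) :=
      (hc.mono fun V (hV : V ∈ C) => ⟨hV.1.1, hV.1.2.2⟩).tendsto
    rw [hγ0 c i] at hc'
    simpa using hc'.norm
  -- the bound along `C`
  set B : (Site d → Fin d → (Matrix n n ℂ)ˣ) → ℝ := fun V => ∑ p ∈ W,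
      2 * (‖γ V (cdivIter L k p.1) p.2.1.1‖ + ‖γ V (cdivIter L k (p.1 + e p.2.1.1)) p.2.1.2‖
        + ‖γ V (cdivIter L k (p.1 + e p.2.1.2)) p.2.1.1‖ + ‖γ V (cdivIter L k p.1) p.2.1.2‖) with hB
  have hBt : Tendsto B (𝓝[C] U) (𝓝 0) := by
    have h : Tendsto B (𝓝[C] U) (𝓝 (∑ p ∈ W, 2 * ((0 : ℝ) + 0 + 0 + 0))) := by
      refine tendsto_finsetSum W fun p _ => ?_
      exact (((hγt _ _).add (hγt _ _)).add (hγt _ _) |>.add (hγt _ _)).const_mul 2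
    simpa using h
  have hbound : ∀ V ∈ C, |dAction V φ W| ≤ B V := by
    intro V hV
    obtain ⟨⟨hVu, hVP, hVx⟩, hVcrit⟩ := hV
    have hVP' : IsPeriodicCfg V ((L : ℤ) * (tower L N k : ℕ)) := by rw [← eP]; exact hVP
    have hφP' : IsPeriodicDir φ ((L : ℤ) * (tower L N k : ℕ)) := by rw [← eP]; exact hφP
    -- the tangent representative at `V`
    have hγs : IsSkewDir (γ V) := isSkewDir_cpushIter hL1 k hVu hx hls hVx hφs
    have hγP : IsPeriodicDir (γ V) (N : ℤ) := isPeriodicDir_cpushIter L N k hVP' hφP'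
    set ψ := liftIter L k V x (γ V) with hψ
    have hψs : IsSkewDir ψ := isSkewDir_liftIter hL1 k hVu hx hls hVx fun y κ => hγs y κ
    have hψP : IsPeriodicDir ψ ((N * L ^ (k + 1) : ℕ) : ℤ) := by
      rw [eP]; exact isPeriodicDir_liftIter hL1 N k hVu hx hls hVx hVP' fun y i κ => hγP y i κ
    have hT : TangentIter L k V (φ - ψ) := tangentIter_sub_liftIter hL1 k hVu hx hls hVx φ
    have hsk : IsSkewDir (φ - ψ) := fun y κ => by
      simpa only [Pi.sub_apply] using (skewAdjoint (Matrix n n ℂ)).sub_mem (hφs y κ) (hψs y κ)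
    have hsP : IsPeriodicDir (φ - ψ) ((N * L ^ (k + 1) : ℕ) : ℤ) := fun y i κ => by
      simp only [Pi.sub_apply, hφP y i κ, hψP y i κ]
    have h0 := hVcrit (φ - ψ) hsk hsP hT
    have hsplit : dAction V φ W = dAction V ψ W := by
      have h := dAction_add V (φ - ψ) ψ W
      rw [sub_add_cancel, h0, zero_add] at h
      exact h
    rw [hsplit]
    refine (abs_dAction_le_sum_norm hVu ψ W).trans (Finset.sum_le_sum fun p _ => ?_)
    have hc := norm_curlAt_le hVu ψ p.1 p.2.1.1 p.2.1.2
    have hb := fun z i => norm_liftIter_le_two hL k hVu hx hls hVx (γ V) z i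
    have e1 : curl V ψ p = curlAt V ψ p.1 p.2.1.1 p.2.1.2 := rfl
    rw [e1]
    calc ‖curlAt V ψ p.1 p.2.1.1 p.2.1.2‖
        ≤ ‖ψ p.1 p.2.1.1‖ + ‖ψ (p.1 + e p.2.1.1) p.2.1.2‖ + ‖ψ (p.1 + e p.2.1.2) p.2.1.1‖ + ‖ψ p.1 p.2.1.2‖ := hc
      _ ≤ 2 * ‖γ V (cdivIter L k p.1) p.2.1.1‖ + 2 * ‖γ V (cdivIter L k (p.1 + e p.2.1.1)) p.2.1.2‖
          + 2 * ‖γ V (cdivIter L k (p.1 + e p.2.1.2)) p.2.1.1‖ + 2 * ‖γ V (cdivIter L k p.1) p.2.1.2‖ := by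
          gcongr <;> exact hb _ _
      _ = _ := by ring
  -- squeeze: the first variation tends to `0` along `C`, hence equals `0` at `U`
  have hf0 : Tendsto (fun V : Site d → Fin d → (Matrix n n ℂ)ˣ => dAction V φ W) (𝓝[C] U) (𝓝 0) := by
    refine squeeze_zero_norm' ?_ hBt
    filter_upwards [self_mem_nhdsWithin] with V hV
    rw [Real.norm_eq_abs]
    exact hbound V hV
  exact tendsto_nhds_unique hf hf0

/-! ## §3 The continuity method with an abstract criticality predicate; CRIT-ONE-STEP (tangent currency) with CLOSED discharged -/

/-- **THE CLOSED HALF WITH AN ABSTRACT CRITICALITY PREDICATE** (F16's `isClosed_critSet_param` verbatim with the `ker levelQ'` clause replaced by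
`P U`): for `γ` continuous on `[0,1]` and `{U ∈ sfClass | P U}` closed, the set of `τ ∈ [0,1]` carrying an admissible `U` with `SmallField U r` and `P U` is
closed. [folklore] -/
theorem isClosed_critSet_param' [Nonempty n] {L N k : ℕ} (hL : 2 ≤ L) {ε r : ℝ} (hε0 : 0 ≤ ε)
    (hε1 : 16 * C0 d * ε ≤ 3) (hε2 : 1024 * (d + 1) * (d + 4) * (L : ℝ) ^ 2 * ε ≤ 1)
    (γ : ℝ → (Site d → Fin d → (Matrix n n ℂ)ˣ)) (hγ : ContinuousOn γ (Icc (0 : ℝ) 1))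
    (P : (Site d → Fin d → (Matrix n n ℂ)ˣ) → Prop)
    (hcc : IsClosed {U : Site d → Fin d → (Matrix n n ℂ)ˣ | U ∈ sfClass d L N ε (k + 1) ∧ P U}) :
    IsClosed {τ : ℝ | τ ∈ Icc (0 : ℝ) 1 ∧ ∃ U : Site d → Fin d → (Matrix n n ℂ)ˣ,
      U ∈ admissible (sfClass d L N ε) L (k + 1) (γ τ) ∧ SmallField U r ∧ P U} := by
  set K : Set (ℝ × (Site d → Fin d → (Matrix n n ℂ)ˣ)) := Icc (0 : ℝ) 1 ×ˢ sfClass d L N ε (k + 1) with hK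
  have hKc : IsCompact K := isCompact_Icc.prod (isCompact_sfClass (d := d) (n := n) L N ε (k + 1))
  have hKcl : IsClosed K := hKc.isClosed
  have havg : ContinuousOn (fun U : Site d → Fin d → (Matrix n n ℂ)ˣ => avgIter L U (k + 1)) (sfClass d L N ε (k + 1)) :=
    (continuousOn_avgIter (d := d) (n := n) hL hε0 hε1 hε2 (k + 1) (k + 1) le_rfl).mono fun U hU => ⟨hU.1, hU.2.2⟩
  have hG : ContinuousOn (fun p : ℝ × (Site d → Fin d → (Matrix n n ℂ)ˣ) => (avgIter L p.2 (k + 1), γ p.1)) K := by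
    refine ContinuousOn.prodMk ?_ ?_
    · exact havg.comp continuousOn_snd fun p hp => (mem_prod.mp hp).2
    · exact hγ.comp continuousOn_fst fun p hp => (mem_prod.mp hp).1
  have hA : IsClosed (K ∩ (fun p : ℝ × (Site d → Fin d → (Matrix n n ℂ)ˣ) => (avgIter L p.2 (k + 1), γ p.1)) ⁻¹'
      (Set.diagonal (Site d → Fin d → (Matrix n n ℂ)ˣ))) :=
    hG.preimage_isClosed_of_isClosed hKcl isClosed_diagonal
  have hB : IsClosed ((Prod.snd : ℝ × (Site d → Fin d → (Matrix n n ℂ)ˣ) → _) ⁻¹'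
      {U : Site d → Fin d → (Matrix n n ℂ)ˣ | SmallField U r}) :=
    (isClosed_smallField (d := d) (n := n) r).preimage continuous_snd
  have hC := hcc.preimage (continuous_snd : Continuous (Prod.snd : ℝ × (Site d → Fin d → (Matrix n n ℂ)ˣ) → _))
  set Z : Set (ℝ × (Site d → Fin d → (Matrix n n ℂ)ˣ)) :=
    (K ∩ (fun p : ℝ × (Site d → Fin d → (Matrix n n ℂ)ˣ) => (avgIter L p.2 (k + 1), γ p.1)) ⁻¹'
      (Set.diagonal (Site d → Fin d → (Matrix n n ℂ)ˣ))) ∩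
    ((Prod.snd : ℝ × (Site d → Fin d → (Matrix n n ℂ)ˣ) → _) ⁻¹' {U : Site d → Fin d → (Matrix n n ℂ)ˣ | SmallField U r}) ∩
    ((Prod.snd : ℝ × (Site d → Fin d → (Matrix n n ℂ)ˣ) → _) ⁻¹'
      {U : Site d → Fin d → (Matrix n n ℂ)ˣ | U ∈ sfClass d L N ε (k + 1) ∧ P U}) with hZ
  have hZcl : IsClosed Z := (hA.inter hB).inter hC
  have hZK : Z ⊆ K := fun p hp => hp.1.1.1
  have hZc : IsCompact Z := hKc.of_isClosed_subset hZcl hZK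
  have hSc : IsCompact (Prod.fst '' Z) := hZc.image continuous_fst
  have hset : {τ : ℝ | τ ∈ Icc (0 : ℝ) 1 ∧ ∃ U : Site d → Fin d → (Matrix n n ℂ)ˣ,
      U ∈ admissible (sfClass d L N ε) L (k + 1) (γ τ) ∧ SmallField U r ∧ P U} = Prod.fst '' Z := by
    ext τ
    simp only [mem_setOf_eq, mem_image, Prod.exists, exists_and_right, exists_eq_right]
    constructor
    · rintro ⟨hτI, U, ⟨hUcl, hUavg⟩, hUr, hUP⟩
      refine ⟨U, ?_⟩
      rw [hZ]
      refine ⟨⟨⟨?_, ?_⟩, hUr⟩, ⟨hUcl, hUP⟩⟩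
      · rw [hK]; exact mem_prod.mpr ⟨hτI, hUcl⟩
      · exact Set.mem_preimage.mpr (Set.mem_diagonal_iff.mpr hUavg)
    · rintro ⟨U, hp⟩
      rw [hZ] at hp
      obtain ⟨⟨⟨hpK, hpA⟩, hpr⟩, ⟨hUcl, hUP⟩⟩ := hp
      rw [hK] at hpK
      obtain ⟨hτI, -⟩ := mem_prod.mp hpK
      have hUavg : avgIter L U (k + 1) = γ τ := Set.mem_diagonal_iff.mp (Set.mem_preimage.mp hpA)
      exact ⟨hτI, U, ⟨hUcl, hUavg⟩, hpr, hUP⟩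
  rw [hset]
  exact hSc.isClosed

/-- **THE CONTINUITY METHOD WITH AN ABSTRACT CRITICALITY PREDICATE** (F16's `critOneStep_of_continuity` verbatim with `P U`). [folklore] -/
theorem critOneStep_of_continuity' [Nonempty n] {L N k : ℕ} (hL : 2 ≤ L) {ε r : ℝ} (hε0 : 0 ≤ ε)
    (hε1 : 16 * C0 d * ε ≤ 3) (hε2 : 1024 * (d + 1) * (d + 4) * (L : ℝ) ^ 2 * ε ≤ 1)
    (γ : ℝ → (Site d → Fin d → (Matrix n n ℂ)ˣ)) (hγ : ContinuousOn γ (Icc (0 : ℝ) 1))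
    (P : (Site d → Fin d → (Matrix n n ℂ)ˣ) → Prop)
    (h0 : ∃ U : Site d → Fin d → (Matrix n n ℂ)ˣ, U ∈ admissible (sfClass d L N ε) L (k + 1) (γ 0) ∧ SmallField U r ∧ P U)
    (hcc : IsClosed {U : Site d → Fin d → (Matrix n n ℂ)ˣ | U ∈ sfClass d L N ε (k + 1) ∧ P U})
    (hopen : ∀ τ₀ ∈ Icc (0 : ℝ) 1,
      (∃ U : Site d → Fin d → (Matrix n n ℂ)ˣ, U ∈ admissible (sfClass d L N ε) L (k + 1) (γ τ₀) ∧ SmallField U r ∧ P U) →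
      ∃ ρ : ℝ, 0 < ρ ∧ ∀ τ ∈ Icc (0 : ℝ) 1, |τ - τ₀| < ρ →
        ∃ U : Site d → Fin d → (Matrix n n ℂ)ˣ, U ∈ admissible (sfClass d L N ε) L (k + 1) (γ τ) ∧ SmallField U r ∧ P U) :
    ∀ τ ∈ Icc (0 : ℝ) 1, ∃ U : Site d → Fin d → (Matrix n n ℂ)ˣ, U ∈ admissible (sfClass d L N ε) L (k + 1) (γ τ) ∧ SmallField U r ∧ P U := by
  set S : Set ℝ := {τ : ℝ | τ ∈ Icc (0 : ℝ) 1 ∧ ∃ U : Site d → Fin d → (Matrix n n ℂ)ˣ,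
      U ∈ admissible (sfClass d L N ε) L (k + 1) (γ τ) ∧ SmallField U r ∧ P U} with hS
  have hcl : IsClosed S := by rw [hS]; exact isClosed_critSet_param' hL hε0 hε1 hε2 γ hγ P hcc
  have h0S : (0 : ℝ) ∈ S := by rw [hS]; exact ⟨⟨le_rfl, zero_le_one⟩, h0⟩
  have hop : ∀ τ₀ ∈ Icc (0 : ℝ) 1, τ₀ ∈ S → ∃ ρ : ℝ, 0 < ρ ∧ ∀ τ ∈ Icc (0 : ℝ) 1, |τ - τ₀| < ρ → τ ∈ S := by
    intro τ₀ hτ₀I hτ₀S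
    rw [hS] at hτ₀S
    obtain ⟨ρ, hρ, hball⟩ := hopen τ₀ hτ₀I hτ₀S.2
    refine ⟨ρ, hρ, fun τ hτI hτρ => ?_⟩
    rw [hS]
    exact ⟨hτI, hball τ hτI hτρ⟩
  intro τ hτ
  have hτS := Icc_subset_of_closed_of_relOpen h0S hcl hop hτ
  rw [hS] at hτS
  exact hτS.2

/-- **CRIT-ONE-STEP (TANGENT CURRENCY) BY CONTINUITY ALONG A DATA PATH — CLOSED DISCHARGED.**  At level `k+1` of `sfClass d L N ε` (`L ≥ 2`, `N ≥ 1`,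
`16C₀ε ≤ 3`, `1024(d+1)(d+4)L²ε ≤ 1`, `LevelSmall d L k (ε(L^{k+1})^{−2})`), let `γ` be a data path continuous on `[0,1]` with, AT `γ 0`, an admissible
configuration of radius `r` critical on the tangent space `T(·)`; ASSUME (OPEN) (a-priori estimate with margin + local continuation — ALL the analysis).  THEN
every `τ ∈ [0,1]` carries such a configuration; the CLOSED half is §2 + `MinimalActionCompact`. [folklore] -/
theorem critOneStep_tan_of_continuity [Nonempty n] {L N k : ℕ} [NeZero N] (hL : 2 ≤ L) {ε r : ℝ} (hε0 : 0 ≤ ε)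
    (hε1 : 16 * C0 d * ε ≤ 3) (hε2 : 1024 * (d + 1) * (d + 4) * (L : ℝ) ^ 2 * ε ≤ 1) (hls : LevelSmall d L k (ε / ((L : ℝ) ^ (k + 1)) ^ 2))
    (γ : ℝ → (Site d → Fin d → (Matrix n n ℂ)ˣ)) (hγ : ContinuousOn γ (Icc (0 : ℝ) 1))
    (h0 : ∃ U : Site d → Fin d → (Matrix n n ℂ)ˣ, U ∈ admissible (sfClass d L N ε) L (k + 1) (γ 0) ∧ SmallField U r ∧
      ∀ φ : Site d → Fin d → Matrix n n ℂ, IsSkewDir φ → IsPeriodicDir φ ((N * L ^ (k + 1) : ℕ) : ℤ) → TangentIter L k U φ →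
        dAction U φ (perWin d (N * L ^ (k + 1))) = 0)
    (hopen : ∀ τ₀ ∈ Icc (0 : ℝ) 1,
      (∃ U : Site d → Fin d → (Matrix n n ℂ)ˣ, U ∈ admissible (sfClass d L N ε) L (k + 1) (γ τ₀) ∧ SmallField U r ∧
        ∀ φ : Site d → Fin d → Matrix n n ℂ, IsSkewDir φ → IsPeriodicDir φ ((N * L ^ (k + 1) : ℕ) : ℤ) → TangentIter L k U φ →
          dAction U φ (perWin d (N * L ^ (k + 1))) = 0) →
      ∃ ρ : ℝ, 0 < ρ ∧ ∀ τ ∈ Icc (0 : ℝ) 1, |τ - τ₀| < ρ →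
        ∃ U : Site d → Fin d → (Matrix n n ℂ)ˣ, U ∈ admissible (sfClass d L N ε) L (k + 1) (γ τ) ∧ SmallField U r ∧
          ∀ φ : Site d → Fin d → Matrix n n ℂ, IsSkewDir φ → IsPeriodicDir φ ((N * L ^ (k + 1) : ℕ) : ℤ) → TangentIter L k U φ →
            dAction U φ (perWin d (N * L ^ (k + 1))) = 0) :
    ∀ τ ∈ Icc (0 : ℝ) 1, ∃ U : Site d → Fin d → (Matrix n n ℂ)ˣ, U ∈ admissible (sfClass d L N ε) L (k + 1) (γ τ) ∧ SmallField U r ∧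
      ∀ φ : Site d → Fin d → Matrix n n ℂ, IsSkewDir φ → IsPeriodicDir φ ((N * L ^ (k + 1) : ℕ) : ℤ) → TangentIter L k U φ →
        dAction U φ (perWin d (N * L ^ (k + 1))) = 0 :=
  critOneStep_of_continuity' hL hε0 hε1 hε2 γ hγ
    (fun U => ∀ φ : Site d → Fin d → Matrix n n ℂ, IsSkewDir φ → IsPeriodicDir φ ((N * L ^ (k + 1) : ℕ) : ℤ) → TangentIter L k U φ →
      dAction U φ (perWin d (N * L ^ (k + 1))) = 0)
    h0 (isClosed_tanCritical (N := N) hL hε0 hls) hopen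

end

end Summit.QuantumFields.BalabanUV.T4Continuum.NE7CritClosed
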